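import Summits.RiemannHypothesis.RiemannHypothesis.Theorems.TiltedLandingLaw421R3ClusterQMP
import Literature.NumberTheory.LFunctions.NymanBeurlingVectorsOrthogonal

/-!
# W-08 · C1 (rh-idea-5 g28) — `NewtonDoor`: the ISOLATED-STRONG-FIELD door for the SUCC residual (`RhW08.SuccSplit.AntiEscapeCore`, #1053)

SUPPORT only (candidate `…/Theorems/TiltedLandingLaw421R3NewtonDoor.lean`, `--supports stmt-RiemannHypothesis-33346 --as helper`): proves no stub, no
crux, no `sorry`; NO LAW is typed ((CA387)(2)).  Census behind it: C1 g28 SCAN-REPORT v8 §Addenda 2–5 (the zero of `f^{(j+1)}` nearest to the lowest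
band state `v` is the NEWTON STEP `v − 1/K`, `K` = the cofactor field at `v`; residual ≤ 1/8 of the step in 98.8 % of strong-tilt windows).

★ `succ_of_newton_door`: legal frame, band state `v` at level `j`, a factorisation `f^{(j)} = (z − v)·h` with `h` entire, ANY non-zero constant `K`
(intended: `h′(v)/h(v)`), a radius fraction `ρ₀ > 0`; on the NEWTON DISC `‖z − (v − K⁻¹)‖ ≤ ρ₀/‖K‖`: `h` zero-free, the disc off the real axis
(`ρ₀/‖K‖ ≤ |Im (v − K⁻¹)|`), the FIELD-VARIATION domination `‖z − v‖·‖h′(z) − K·h(z)‖ < ρ₀·‖h(z)‖` on the circle, and the level-`(j+1)` band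
inequality at every point of the open disc with `|Im| ≤ Hs` (the SLACK input) ⇒ a level-`(j+1)` band state.
Proof = the tree's pointwise upper model door `RhW08.ClusterQM.succ_of_upper_model_zero_pt` ((B4), Rouché via `exists_deriv_zero_of_model_zero`) with the
LINEAR model `M z = 1 + K·(z − v)` (zero at the Newton point `v − K⁻¹`), using the identity `f^{(j+1)} − M·h = (z − v)·(h′ − K·h)` and
`‖M z‖ = ‖K‖·‖z − (v − K⁻¹)‖ = ρ₀` on the circle.  The factorisation input is DISCHARGED here (`h := dslope (f^{(j)}) v`: `succ_of_newton_door'`) and so is the slack input, from ONE scalar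
inequality (`band_of_slack`, `newtonDisc_geometry`, `newtonCentre_im_pos`: ★★ `succ_of_newton_door_slack`).  What is left for a hand: the
field-variation domination (and the zero-freeness of the cofactor on the Newton disc) from zero isolation — ONE log-derivative Lipschitz bound
`|h′/h(z) − h′/h(v)| ≤ ‖z − v‖·Σ_{a ≠ v} m_a/(|z − a|·|v − a|)` for the order-`< 2` engine class (`Literature.Analysis.Complex.hadamard_genus_one_zeros`
route, or the local `LogDerivZerosDisc` route with a growth constant).  LIPSCHITZ FORM ★★★ `succ_of_newton_door_lip` (‖h′/h − K‖ ≤ Λ on the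
Newton circle, (1+ρ₀)Λ < ρ₀‖K‖) and the assembly of Λ = near pole-sum variation (`nearSum_variation[_of_isolated]`, proved here) + far-factor
Lipschitz term (`lipschitz_of_near_far`; the constant from `Literature.Analysis.Complex.KimLee.norm_logDeriv_sub_logDeriv_zero_le`); the
NEAR/FAR SPLIT identity `h′/h = Σ m_a/(z − a) + G′/G` at a point where `h` agrees locally with `(∏ (· − a)^{m_a})·G` (`logDeriv_nearFar`, `field_split`);
the FAR-FIELD LIPSCHITZ constant, centre-free (`lipschitz_of_bounded_holo`: a field holomorphic and bounded by `ε` one collar `δ` out is `ε/δ`-Lipschitz — Cauchy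
`Complex.norm_deriv_le_of_forall_mem_sphere_norm_le` + `Convex.norm_image_sub_le_of_norm_deriv_le`; the two-point any-centre form of KimLee's lemma).
The COFACTOR LOCAL FACTORISATION is done here too (`dslope_local_factor` = peel one linear factor; `divisor_eq_one_of_simple`, `mem_toFinset_of_simple`;
`cofactor_local_factor` = `Literature.Analysis.Complex.exists_eq_prod_pow_sub_mul` for `F` about a non-zero point, peeled at the simple zero `v`:
far factor `G`, near set `S ∋ v` inside the inner ball, multiplicities `D`, `D v = 1`, and `h = (∏_{S∖{v}}(· − u)^{D u})·G` near every `z ≠ v`).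
The FAR-FIELD BOUND is done here too: `farField_bound_of_ne_zero` (Landau's lemma at centre `c`, `Literature.Analysis.Complex.norm_logDeriv_sub_sum_le`,
minus the near sum via `field_split`: `‖G′/G(z)‖ ≤ (2r₁/((R₂ − r₁)(r₁ − r)))·(log(B/|F c|) + N log(R/(R − R₂)) + 1)` for `‖z − c‖ ≤ r`, `F z ≠ 0`)
and `bound_of_bound_off_zeros` (the proviso `F z ≠ 0` removed on the open ball by isolation of zeros + continuity).
The identity AT `v` (`dslope_local_factor_at`, uniqueness of limits along `𝓝[≠] v`) makes the Newton-door field CANONICAL: `cofactor_local_factor_at` adds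
`h′(v)/h(v) = Σ_{S∖{v}} D_u/(v − u) + G′(v)/G(v)` — take `K := h′(v)/h(v) = F″(v)/(2F′(v))` in `succ_of_newton_door_lip` and `lipschitz_of_near_far`.
The ASSEMBLY is done here as well: `lipschitz_on_newton_circle` (the `hlip` of `succ_of_newton_door_lip` from Landau-disc data: containments, isolation
distance `d`, divisor mass `≤ Nb`, `ε ≥` the Landau constant; near set/multiplicities named `nearSet`/`nearMult`) and ★★★★ `succ_of_newton_door_landau`
(ENGINE LEVEL: `EngineHyps5` + `StTrkDQ … j v` + scalar/containment data ⇒ successor, canonical `K = h′(v)/h(v)`), and the EXACT door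
★ `succ_of_newton_door_polyexp` for `f^{(j)} = (∏_{a∈S}(· − a)^{m_a})·e^{A+γz}` (census frames; finite model of C3 g41's genus-one two-point identity —
the exponential CANCELS in `h′/h(z) − h′/h(v)`): END CONDITION `(1+ρ₀)·r_N·Σ_{a≠v} m_a/((‖v−a‖ − r_N)‖v−a‖) < ρ₀‖K‖`, no radii, no far field (`dslope_eq_of_factor`);
and in SERIES form ★ `succ_of_newton_door_tsum` (any zero list `a : ι → ℂ`, weights `m ≥ 0`, the two-point identity `h′/h(z) − K = Σ' m_i(1/(z−a_i) − 1/(v−a_i))`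
on the Newton circle as HYPOTHESIS — the genus-one Hadamard product supplies it for order < 2 — ⇒ successor under the same single end condition; `tsum_variation`), and in TWO-POINT-BOUND form ★ `succ_of_newton_door_twoPoint` (HYPOTHESIS = the
z-dependent bound `‖h′/h(z) − K‖ ≤ ‖z−v‖·Σ' m_i/(‖z−a_i‖‖v−a_i‖)` = C3 g41 RESULT-5 `norm_logDeriv_sub_logDeriv_le` in zero coordinates; `tsum_twoPoint_le`; primed variant `succ_of_newton_door_twoPoint'` discharges the
zero-free-disc clause from a complete zero list + separation, `cofactor_ne_zero_of_separated`; separation is asked only of POSITIVELY WEIGHTED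
zeros, and `summable_majorant_of_summable_norm_sq` supplies the summability hypothesis from `Σ‖b n‖² < ∞` in the inverse-zero parametrisation
`a_n = (b n)⁻¹`, `m_n = [b n ≠ 0]` of C3 g41's `dslope_twoPoint` — so the general-`f` door is `_twoPoint'` + C3 RESULT-7 + NUMBERS; and
★ `succ_of_newton_door_twoPointU` matches C3's ι-form `twoPoint_bound_dslope` VERBATIM (unweighted complete list, bound at w = v, summability at z = w = v)
under UNIFORM separation `r_N + δ ≤ ‖v − a_i‖`, via `summable_majorant_of_uniform_sep`).
What a hand still supplies is NUMBERS ONLY (historical recipe kept below): chain `cofactor_local_factor_at` → `field_split` (near identity on the Newton circle),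
`farField_bound_of_ne_zero` + `bound_of_bound_off_zeros` + `lipschitz_of_bounded_holo` (far Lipschitz `L = ε/δ` on a collar inside `‖z − c‖ < r`),
`lipschitz_of_near_far` (Λ), `succ_of_newton_door_lip`; inputs = `|F| ≤ B` on the big ball (growth of `f^{(j)}`), the isolation distance `d` of
`S ∖ {v}` from the circle, radii bookkeeping, and the scalar end condition `(1+ρ₀)Λ < ρ₀‖K‖` + slack.
Nothing here bears on the truth of RH; RH is NOT proved; 24774 → 33346/33347 OPEN; `AntiEscapeCore` OPEN.
-/

namespace RhW08.NewtonDoor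

open Complex Set
open scoped ComplexConjugate
open Literature.Analysis.Complex
open Summit.RiemannHypothesis.RiemannHypothesis.Theorems.Splittings.JensenWindow
open RhIdea6.G17.W07C7 RhIdea6.G17.W07C7.Rev6 RhIdea6.G18.W07C8.Law421BirthS RhIdea6.G19.W07C11.Seam
open RhIdea6.G20.W07C12.Frac RhIdea6.G20.W07C12.StColP RhW07.C12.FieldSplit RhIdea6.G21.W07C13.TentMax
open RhW07.C14.TwoSided RhW07.C14.Classes RhW07.C14.Lineage RhW07.C14.Booking
open RhW07.C13.Heredity RhIdea6.G22.W07C15pre.Injection RhW07.E3.Cell RhW07.E3.Lit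
open RhW08.Round1 RhW08.StSwap RhW08.Round2 RhW08.QuadW RhW08.SealSwapQ RhW08.SuccB RhW08.SuccSplit RhW08.SuccTheft
open RhW08.Column RhW08.Hurwitz
open RhW08.ClusterQ RhW08.ClusterQM

/-- The LINEAR MODEL `1 + K·(z − v)` equals `K·(z − (v − K⁻¹))` for `K ≠ 0`. -/
theorem linModel_eq {K : ℂ} (hK : K ≠ 0) (v z : ℂ) : 1 + K * (z - v) = K * (z - (v - K⁻¹)) := by
  have h1 : K * K⁻¹ = 1 := mul_inv_cancel₀ hK
  linear_combination -h1

/-- The linear model vanishes at the NEWTON POINT `v − K⁻¹`. -/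
theorem linModel_newton {K : ℂ} (hK : K ≠ 0) (v : ℂ) : 1 + K * ((v - K⁻¹) - v) = 0 := by
  rw [linModel_eq hK]; simp

/-- The linear model is not the zero function (it is `1` at `v`). -/
theorem linModel_ne_zero (K v : ℂ) : (fun z : ℂ => 1 + K * (z - v)) ≠ 0 := by
  intro h0
  have h1 := congrArg (fun g : ℂ → ℂ => g v) h0
  simp at h1

/-- Derivative of the factorised level function: `((z − v)·h)′ = h + (z − v)·h′`. -/
theorem deriv_factor {h : ℂ → ℂ} (hh : Differentiable ℂ h) (v z : ℂ) :
    deriv (fun y : ℂ => (y - v) * h y) z = h z + (z - v) * deriv h z := by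
  have hd : HasDerivAt (fun y : ℂ => (y - v) * h y) (1 * h z + (z - v) * deriv h z) z :=
    ((hasDerivAt_id' z).sub_const v).mul (hh z).hasDerivAt
  rw [hd.deriv, one_mul]

/-- The ROUCHÉ DEFECT of the linear model is the FIELD VARIATION: `(h + (z − v)h′) − (1 + K(z − v))·h = (z − v)·(h′ − K·h)`. -/
theorem defect_eq (h : ℂ → ℂ) (K v z : ℂ) :
    (h z + (z - v) * deriv h z) - (1 + K * (z - v)) * h z = (z - v) * (deriv h z - K * h z) := by ring

/-- On the Newton circle `‖z − (v − K⁻¹)‖ = ρ₀/‖K‖` the linear model has modulus exactly `ρ₀`. -/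
theorem norm_linModel_circle {K : ℂ} (hK : K ≠ 0) {v z : ℂ} {ρ₀ : ℝ} (hz : ‖z - (v - K⁻¹)‖ = ρ₀ / ‖K‖) :
    ‖1 + K * (z - v)‖ = ρ₀ := by
  have hKn : ‖K‖ ≠ 0 := norm_ne_zero_iff.mpr hK
  rw [linModel_eq hK, norm_mul, hz]
  field_simp

/-- ★ THE NEWTON DOOR (isolated strong field): see the module docstring. -/
theorem succ_of_newton_door {η : ℝ} {f : ℂ → ℂ} {x₀ s hmax R Hs : ℝ} {B j : ℕ} {v : ℂ} (hE : EngineHyps5 2 η f x₀ s hmax R Hs B)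
    (hv : StTrkDQ η f x₀ s hmax R Hs B j v) {h : ℂ → ℂ} (hh : Differentiable ℂ h)
    (hfac : ∀ z : ℂ, iteratedDeriv j f z = (z - v) * h z) {K : ℂ} (hK : K ≠ 0) {ρ₀ : ℝ} (hρ₀ : 0 < ρ₀)
    (hoff : ρ₀ / ‖K‖ ≤ |(v - K⁻¹).im|)
    (hh0 : ∀ z : ℂ, ‖z - (v - K⁻¹)‖ ≤ ρ₀ / ‖K‖ → h z ≠ 0)
    (hvar : ∀ z : ℂ, ‖z - (v - K⁻¹)‖ = ρ₀ / ‖K‖ → ‖z - v‖ * ‖deriv h z - K * h z‖ < ρ₀ * ‖h z‖)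
    (hdisc : ∀ z : ℂ, ‖z - (v - K⁻¹)‖ < ρ₀ / ‖K‖ → |z.im| ≤ Hs →
      (max (|z.re - x₀| - R / 2) 0) ^ 2 + ((j : ℝ) + 1) * z.im ^ 2 ≤ ((j : ℝ) + 1) * Hs ^ 2) :
    ∃ u : ℂ, StTrkDQ η f x₀ s hmax R Hs B (j + 1) u := by
  have hρ : 0 < ρ₀ / ‖K‖ := div_pos hρ₀ (norm_pos_iff.mpr hK)
  have hM : Differentiable ℂ (fun z : ℂ => 1 + K * (z - v)) := by fun_prop
  have hF : iteratedDeriv j f = fun y : ℂ => (y - v) * h y := funext hfac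
  have hsucc : ∀ z : ℂ, iteratedDeriv (j + 1) f z = h z + (z - v) * deriv h z := by
    intro z
    rw [iteratedDeriv_succ, hF]
    exact deriv_factor hh v z
  have hdom : ∀ z : ℂ, ‖z - (v - K⁻¹)‖ = ρ₀ / ‖K‖ →
      ‖iteratedDeriv (j + 1) f z - (1 + K * (z - v)) * h z‖ < ‖(1 + K * (z - v)) * h z‖ := by
    intro z hz
    rw [hsucc z, defect_eq h K v z, norm_mul, norm_mul, norm_linModel_circle hK hz]
    exact hvar z hz
  have hMz : ∃ z₀ : ℂ, ‖z₀ - (v - K⁻¹)‖ < ρ₀ / ‖K‖ ∧ 1 + K * (z₀ - v) = 0 :=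
    ⟨v - K⁻¹, by simpa using hρ, linModel_newton hK v⟩
  exact succ_of_upper_model_zero_pt hE hv hρ hoff hh hM (linModel_ne_zero K v) hh0 hdom hMz hdisc

/-- ★ COROLLARY (multiple zero): if the band state `v` is a MULTIPLE zero of `f^{(j)}` (so `f^{(j+1)}(v) = 0`), it is itself a level-`(j+1)` band
state's worth: the pointwise door applies at `z = v` (band_j ⇒ band_{j+1} at the same point since `Im v ≤ Hs`).  Hence the Newton door may assume
`v` simple, i.e. `h v ≠ 0`. -/
theorem succ_of_multiple {η : ℝ} {f : ℂ → ℂ} {x₀ s hmax R Hs : ℝ} {B j : ℕ} {v : ℂ} (hE : EngineHyps5 2 η f x₀ s hmax R Hs B)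
    (hv : StTrkDQ η f x₀ s hmax R Hs B j v) (hz : iteratedDeriv (j + 1) f v = 0) :
    ∃ u : ℂ, StTrkDQ η f x₀ s hmax R Hs B (j + 1) u := by
  have hvim : 0 < v.im := hv.2.2.1
  have hband : (max (|v.re - x₀| - R / 2) 0) ^ 2 + (j : ℝ) * v.im ^ 2 ≤ (j : ℝ) * Hs ^ 2 := hv.2.2.2.1
  have hle : v.im ≤ Hs := hv.2.2.2.2
  refine succ_of_nonreal_zero_inBand hE hv hz (ne_of_gt hvim) ?_
  have hsq : v.im ^ 2 ≤ Hs ^ 2 := by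
    have h0 : 0 ≤ v.im := hvim.le
    nlinarith
  nlinarith

/-! ## The factorisation input, discharged: `h := dslope (f^{(j)}) v` -/

/-- The factorisation at a zero: `F z = (z − v) · dslope F v z` when `F v = 0`. -/
theorem factor_dslope {F : ℂ → ℂ} {v : ℂ} (hFv : F v = 0) (z : ℂ) : F z = (z - v) * dslope F v z := by
  have h := sub_smul_dslope F v z
  rw [smul_eq_mul, hFv, sub_zero] at h
  exact h.symm

/-- ★ THE NEWTON DOOR stated on `f` alone: `h = dslope (f^{(j)}) v` (the cofactor of the band state), any `K ≠ 0`, `ρ₀ > 0`; Newton disc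
off the axis, cofactor zero-free on it, field-variation domination on the circle, band slack on the disc ⇒ a level-`(j+1)` band state. -/
theorem succ_of_newton_door' {η : ℝ} {f : ℂ → ℂ} {x₀ s hmax R Hs : ℝ} {B j : ℕ} {v : ℂ} (hE : EngineHyps5 2 η f x₀ s hmax R Hs B)
    (hv : StTrkDQ η f x₀ s hmax R Hs B j v) {K : ℂ} (hK : K ≠ 0) {ρ₀ : ℝ} (hρ₀ : 0 < ρ₀)
    (hoff : ρ₀ / ‖K‖ ≤ |(v - K⁻¹).im|)
    (hh0 : ∀ z : ℂ, ‖z - (v - K⁻¹)‖ ≤ ρ₀ / ‖K‖ → dslope (iteratedDeriv j f) v z ≠ 0)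
    (hvar : ∀ z : ℂ, ‖z - (v - K⁻¹)‖ = ρ₀ / ‖K‖ →
      ‖z - v‖ * ‖deriv (dslope (iteratedDeriv j f) v) z - K * dslope (iteratedDeriv j f) v z‖ < ρ₀ * ‖dslope (iteratedDeriv j f) v z‖)
    (hdisc : ∀ z : ℂ, ‖z - (v - K⁻¹)‖ < ρ₀ / ‖K‖ → |z.im| ≤ Hs →
      (max (|z.re - x₀| - R / 2) 0) ^ 2 + ((j : ℝ) + 1) * z.im ^ 2 ≤ ((j : ℝ) + 1) * Hs ^ 2) :
    ∃ u : ℂ, StTrkDQ η f x₀ s hmax R Hs B (j + 1) u := by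
  have hG : Differentiable ℂ (iteratedDeriv j f) := differentiable_iteratedDeriv_of_entire hE.1 j
  exact succ_of_newton_door hE hv (Literature.NumberTheory.LFunctions.BurnolVectors.differentiable_dslope hG v) (fun z => factor_dslope hv.2.1 z) hK hρ₀ hoff hh0 hvar hdisc

/-! ## The slack input, discharged from ONE scalar inequality (interface of C1 g28 `NearestChildSlack`, inlined) -/

/-- The lateral excess of `u` over the column `|Re u − x₀| ≤ R/2`. -/
noncomputable def rhoN (x₀ R : ℝ) (u : ℂ) : ℝ := max (|u.re - x₀| - R / 2) 0

/-- `ρ` is 1-Lipschitz: `ρ u ≤ ρ v + ‖u − v‖`. -/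
theorem rhoN_le_rhoN_add_norm (x₀ R : ℝ) (u v : ℂ) : rhoN x₀ R u ≤ rhoN x₀ R v + ‖u - v‖ := by
  have h1 : |(u - v).re| ≤ ‖u - v‖ := Complex.abs_re_le_norm (u - v)
  rw [Complex.sub_re] at h1
  have h2 : |u.re - x₀| ≤ |v.re - x₀| + |u.re - v.re| := by
    calc |u.re - x₀| = |(v.re - x₀) + (u.re - v.re)| := by congr 1; ring
      _ ≤ |v.re - x₀| + |u.re - v.re| := abs_add_le _ _
  have hn : 0 ≤ ‖u - v‖ := norm_nonneg _
  unfold rhoN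
  rcases le_or_gt 0 (|v.re - x₀| - R / 2) with hv | hv
  · rw [max_eq_left hv]
    exact max_le (by linarith) (by linarith)
  · rw [max_eq_right hv.le]
    exact max_le (by linarith) (by linarith)

/-- SLACK INTERFACE: `u` within `r` of `v`, `Im u > 0`, and `(ρ v + r)² + (j+1)(Im v + r)² ≤ (j+1)·Hs²` ⇒ `u` satisfies the level-`(j+1)`
band inequality. -/
theorem band_of_slack (j : ℕ) (x₀ R Hs r : ℝ) (u v : ℂ) (hdist : ‖u - v‖ ≤ r) (hu : 0 < u.im)
    (hslack : (rhoN x₀ R v + r) ^ 2 + ((j : ℝ) + 1) * (v.im + r) ^ 2 ≤ ((j : ℝ) + 1) * Hs ^ 2) :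
    (max (|u.re - x₀| - R / 2) 0) ^ 2 + ((j : ℝ) + 1) * u.im ^ 2 ≤ ((j : ℝ) + 1) * Hs ^ 2 := by
  have hρu : 0 ≤ rhoN x₀ R u := le_max_right _ _
  have hρ : rhoN x₀ R u ≤ rhoN x₀ R v + r := le_trans (rhoN_le_rhoN_add_norm x₀ R u v) (by linarith)
  have him : u.im ≤ v.im + r := by
    have h1 : |(u - v).im| ≤ ‖u - v‖ := Complex.abs_im_le_norm (u - v)
    rw [Complex.sub_im] at h1
    have h2 := le_abs_self (u.im - v.im)
    linarith
  have hj : (0 : ℝ) ≤ (j : ℝ) := Nat.cast_nonneg j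
  have e1 : (rhoN x₀ R u) ^ 2 ≤ (rhoN x₀ R v + r) ^ 2 := by nlinarith
  have e2 : u.im ^ 2 ≤ (v.im + r) ^ 2 := by nlinarith
  have e3 : ((j : ℝ) + 1) * u.im ^ 2 ≤ ((j : ℝ) + 1) * (v.im + r) ^ 2 :=
    mul_le_mul_of_nonneg_left e2 (by linarith)
  have main : (rhoN x₀ R u) ^ 2 + ((j : ℝ) + 1) * u.im ^ 2 ≤ ((j : ℝ) + 1) * Hs ^ 2 := by linarith
  simpa [rhoN] using main

/-- Geometry of the Newton disc: a point of the open disc `‖z − (v − K⁻¹)‖ < ρ₀/‖K‖` lies within `(1 + ρ₀)/‖K‖` of `v`, and in the UPPER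
half-plane when the disc is off the axis (`ρ₀/‖K‖ ≤ |Im (v − K⁻¹)|`) with `Im (v − K⁻¹) > 0` (automatic once `‖K‖·Im v > 1`). -/
theorem newtonDisc_geometry {K v z : ℂ} (hK : K ≠ 0) {ρ₀ : ℝ} (hz : ‖z - (v - K⁻¹)‖ < ρ₀ / ‖K‖)
    (hoff : ρ₀ / ‖K‖ ≤ |(v - K⁻¹).im|) (hc : 0 < (v - K⁻¹).im) :
    ‖z - v‖ ≤ (1 + ρ₀) / ‖K‖ ∧ 0 < z.im := by
  have hKn : 0 < ‖K‖ := norm_pos_iff.mpr hK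
  constructor
  · have hsplit : z - v = (z - (v - K⁻¹)) + (-K⁻¹) := by ring
    have hinv : ‖(-K⁻¹ : ℂ)‖ = 1 / ‖K‖ := by rw [norm_neg, norm_inv, one_div]
    calc ‖z - v‖ = ‖(z - (v - K⁻¹)) + (-K⁻¹)‖ := by rw [hsplit]
      _ ≤ ‖z - (v - K⁻¹)‖ + ‖(-K⁻¹ : ℂ)‖ := norm_add_le _ _
      _ ≤ ρ₀ / ‖K‖ + 1 / ‖K‖ := by rw [hinv]; linarith
      _ = (1 + ρ₀) / ‖K‖ := by field_simp; ring
  · have h1 : |(z - (v - K⁻¹)).im| ≤ ‖z - (v - K⁻¹)‖ := Complex.abs_im_le_norm _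
    rw [Complex.sub_im] at h1
    rw [abs_of_pos hc] at hoff
    have h2 := neg_abs_le ((z.im - (v - K⁻¹).im))
    have h3 : |z.im - (v - K⁻¹).im| < (v - K⁻¹).im := lt_of_le_of_lt h1 (lt_of_lt_of_le hz hoff)
    have h4 := (abs_lt.mp h3).1
    linarith

/-- When `‖K‖·Im v > 1` the Newton centre `v − K⁻¹` lies in the upper half-plane. -/
theorem newtonCentre_im_pos {K v : ℂ} (hK : K ≠ 0) (hKy : 1 < ‖K‖ * v.im) : 0 < (v - K⁻¹).im := by
  have hKn : 0 < ‖K‖ := norm_pos_iff.mpr hK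
  have h1 : |(K⁻¹ : ℂ).im| ≤ ‖(K⁻¹ : ℂ)‖ := Complex.abs_im_le_norm _
  rw [norm_inv] at h1
  have h3 : (K⁻¹ : ℂ).im < v.im := by
    have h4 := le_abs_self ((K⁻¹ : ℂ).im)
    have h5 : ‖K‖⁻¹ < v.im := by
      by_contra hle
      have hle' : v.im ≤ ‖K‖⁻¹ := le_of_not_gt hle
      have h6 : ‖K‖ * v.im ≤ ‖K‖ * ‖K‖⁻¹ := mul_le_mul_of_nonneg_left hle' hKn.le
      rw [mul_inv_cancel₀ hKn.ne'] at h6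
      linarith
    linarith
  rw [Complex.sub_im]; linarith

/-- ★★ THE NEWTON DOOR WITH SCALAR SLACK: legal frame, band state `v` at level `j` with `‖K‖·Im v > 1` (off the dimple regime), `K ≠ 0`,
`ρ₀ > 0`, the Newton disc off the axis, the cofactor `dslope (f^{(j)}) v` zero-free on the closed Newton disc with FIELD-VARIATION DOMINATION on
its circle, and the ONE scalar slack inequality `(ρ v + r)² + (j+1)(Im v + r)² ≤ (j+1)·Hs²` with `r = (1 + ρ₀)/‖K‖` ⇒ a level-`(j+1)` band state.
The two analytic inputs left (`hh0`, `hvar`) are both consequences of ONE field-variation (log-derivative Lipschitz) bound from zero isolation. -/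
theorem succ_of_newton_door_slack {η : ℝ} {f : ℂ → ℂ} {x₀ s hmax R Hs : ℝ} {B j : ℕ} {v : ℂ} (hE : EngineHyps5 2 η f x₀ s hmax R Hs B)
    (hv : StTrkDQ η f x₀ s hmax R Hs B j v) {K : ℂ} (hK : K ≠ 0) (hKy : 1 < ‖K‖ * v.im) {ρ₀ : ℝ} (hρ₀ : 0 < ρ₀)
    (hoff : ρ₀ / ‖K‖ ≤ |(v - K⁻¹).im|)
    (hh0 : ∀ z : ℂ, ‖z - (v - K⁻¹)‖ ≤ ρ₀ / ‖K‖ → dslope (iteratedDeriv j f) v z ≠ 0)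
    (hvar : ∀ z : ℂ, ‖z - (v - K⁻¹)‖ = ρ₀ / ‖K‖ →
      ‖z - v‖ * ‖deriv (dslope (iteratedDeriv j f) v) z - K * dslope (iteratedDeriv j f) v z‖ < ρ₀ * ‖dslope (iteratedDeriv j f) v z‖)
    (hslack : (rhoN x₀ R v + (1 + ρ₀) / ‖K‖) ^ 2 + ((j : ℝ) + 1) * (v.im + (1 + ρ₀) / ‖K‖) ^ 2 ≤ ((j : ℝ) + 1) * Hs ^ 2) :
    ∃ u : ℂ, StTrkDQ η f x₀ s hmax R Hs B (j + 1) u := by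
  have hc : 0 < (v - K⁻¹).im := newtonCentre_im_pos hK hKy
  refine succ_of_newton_door' hE hv hK hρ₀ hoff hh0 hvar ?_
  intro z hz _
  obtain ⟨hdist, hzim⟩ := newtonDisc_geometry hK hz hoff hc
  exact band_of_slack j x₀ R Hs ((1 + ρ₀) / ‖K‖) z v hdist hzim hslack

/-! ## The field-variation input in LIPSCHITZ form (interface to `Literature.Analysis.Complex.KimLee.norm_logDeriv_sub_logDeriv_zero_le`) -/

/-- Closed Newton disc ⊂ closed ball of radius `(1 + ρ₀)/‖K‖` about `v`. -/
theorem norm_sub_le_of_newtonDisc {K v z : ℂ} (hK : K ≠ 0) {ρ₀ : ℝ} (hz : ‖z - (v - K⁻¹)‖ ≤ ρ₀ / ‖K‖) :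
    ‖z - v‖ ≤ (1 + ρ₀) / ‖K‖ := by
  have hKn : 0 < ‖K‖ := norm_pos_iff.mpr hK
  have hsplit : z - v = (z - (v - K⁻¹)) + (-K⁻¹) := by ring
  have hinv : ‖(-K⁻¹ : ℂ)‖ = 1 / ‖K‖ := by rw [norm_neg, norm_inv, one_div]
  calc ‖z - v‖ = ‖(z - (v - K⁻¹)) + (-K⁻¹)‖ := by rw [hsplit]
    _ ≤ ‖z - (v - K⁻¹)‖ + ‖(-K⁻¹ : ℂ)‖ := norm_add_le _ _
    _ ≤ ρ₀ / ‖K‖ + 1 / ‖K‖ := by rw [hinv]; linarith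
    _ = (1 + ρ₀) / ‖K‖ := by field_simp; ring

/-- LIPSCHITZ FIELD ⇒ DOMINATION: if on the Newton circle the cofactor field `h′/h` stays within `Λ` of `K` and `(1 + ρ₀)·Λ < ρ₀·‖K‖`, then the
field-variation domination `‖z − v‖·‖h′ − K·h‖ < ρ₀·‖h‖` holds there. -/
theorem fieldVariation_of_lipschitz {h : ℂ → ℂ} {K v : ℂ} (hK : K ≠ 0) {ρ₀ Λ : ℝ} (hΛ : (1 + ρ₀) * Λ < ρ₀ * ‖K‖)
    (hh0 : ∀ z : ℂ, ‖z - (v - K⁻¹)‖ ≤ ρ₀ / ‖K‖ → h z ≠ 0)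
    (hlip : ∀ z : ℂ, ‖z - (v - K⁻¹)‖ = ρ₀ / ‖K‖ → ‖deriv h z / h z - K‖ ≤ Λ) :
    ∀ z : ℂ, ‖z - (v - K⁻¹)‖ = ρ₀ / ‖K‖ → ‖z - v‖ * ‖deriv h z - K * h z‖ < ρ₀ * ‖h z‖ := by
  intro z hz
  have hKn : 0 < ‖K‖ := norm_pos_iff.mpr hK
  have hhz : h z ≠ 0 := hh0 z hz.le
  have hhn : 0 < ‖h z‖ := norm_pos_iff.mpr hhz
  have hfac : deriv h z - K * h z = h z * (deriv h z / h z - K) := by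
    field_simp
  have hzv : ‖z - v‖ ≤ (1 + ρ₀) / ‖K‖ := norm_sub_le_of_newtonDisc hK hz.le
  have hΛ0 : 0 ≤ Λ := le_trans (norm_nonneg _) (hlip z hz)
  rw [hfac, norm_mul]
  have hr0 : 0 ≤ (1 + ρ₀) / ‖K‖ := le_trans (norm_nonneg _) hzv
  have h1 : ‖z - v‖ * (‖h z‖ * ‖deriv h z / h z - K‖) ≤ (1 + ρ₀) / ‖K‖ * (‖h z‖ * Λ) :=
    mul_le_mul hzv (mul_le_mul_of_nonneg_left (hlip z hz) hhn.le) (by positivity) hr0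
  have h2 : (1 + ρ₀) / ‖K‖ * (‖h z‖ * Λ) < ρ₀ * ‖h z‖ := by
    rw [div_mul_eq_mul_div, div_lt_iff₀ hKn]
    nlinarith
  linarith

/-- ★★★ THE NEWTON DOOR, LIPSCHITZ FORM: as `succ_of_newton_door_slack`, with the field-variation domination replaced by a LIPSCHITZ bound
`‖h′/h(z) − K‖ ≤ Λ` on the Newton circle (`h = dslope (f^{(j)}) v`) and the scalar condition `(1 + ρ₀)·Λ < ρ₀·‖K‖`.  With `K = h′/h(v)` the bound
`Λ` is the VARIATION of the cofactor field over the Newton disc — a finite near-zero sum plus the landed far-factor Lipschitz constant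
(`Literature.Analysis.Complex.KimLee.norm_logDeriv_sub_logDeriv_zero_le`). -/
theorem succ_of_newton_door_lip {η : ℝ} {f : ℂ → ℂ} {x₀ s hmax R Hs : ℝ} {B j : ℕ} {v : ℂ} (hE : EngineHyps5 2 η f x₀ s hmax R Hs B)
    (hv : StTrkDQ η f x₀ s hmax R Hs B j v) {K : ℂ} (hK : K ≠ 0) (hKy : 1 < ‖K‖ * v.im) {ρ₀ Λ : ℝ} (hρ₀ : 0 < ρ₀)
    (hΛ : (1 + ρ₀) * Λ < ρ₀ * ‖K‖)
    (hoff : ρ₀ / ‖K‖ ≤ |(v - K⁻¹).im|)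
    (hh0 : ∀ z : ℂ, ‖z - (v - K⁻¹)‖ ≤ ρ₀ / ‖K‖ → dslope (iteratedDeriv j f) v z ≠ 0)
    (hlip : ∀ z : ℂ, ‖z - (v - K⁻¹)‖ = ρ₀ / ‖K‖ →
      ‖deriv (dslope (iteratedDeriv j f) v) z / dslope (iteratedDeriv j f) v z - K‖ ≤ Λ)
    (hslack : (rhoN x₀ R v + (1 + ρ₀) / ‖K‖) ^ 2 + ((j : ℝ) + 1) * (v.im + (1 + ρ₀) / ‖K‖) ^ 2 ≤ ((j : ℝ) + 1) * Hs ^ 2) :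
    ∃ u : ℂ, StTrkDQ η f x₀ s hmax R Hs B (j + 1) u :=
  succ_of_newton_door_slack hE hv hK hKy hρ₀ hoff hh0 (fieldVariation_of_lipschitz hK hΛ hh0 hlip) hslack


end RhW08.NewtonDoor
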